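import Mathlib.GroupTheory.OrderOfElement
import Summits.Ventures.QEC.Census.TwoBlockOrderTwoKernel
import Summits.Ventures.QEC.Census.TwoBlockCyclicKernelTools
import HarnessLib

/-!
# Abelian two-block codes: if `ker A ∩ ker B` contains the indicator of a CYCLIC subgroup of order `2^r`, then `d ≤ 2^r`
# (the kernel-weight bound holds for cyclic 2-power cosets — a one-block logical always survives)

Setting (as in `TwoBlockOrderTwoKernel.lean`, whose `r = 1` case this file generalises): a finite abelian group `G`,
`a, b ∈ 𝔽₂[G]`, the abelian two-block CSS code `css a b` (`H_X = [A|B]`, `H_Z = [Bᵀ|Aᵀ]`), `K = ker A ∩ ker B`, and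
`d(K)` the least weight of a non-zero element of `K`.  The cell's data-conjecture X-2 («`d ≤ d(K)`») is a theorem for
cyclic `G` (Wang–Pryadko 2022 St. 2) and for odd `|G|` (Lin–Pryadko 2024), FALSE in general
(`Census/BB/TwoBlockKernelWeightCounterexample.lean`: `[[48,12,6]]` on `ℤ₂ × ℤ₁₂` with `1_H ∈ K`, `H ≅ ℤ₂ × ℤ₂`, `d = 6 > 4`).

**Theorem of this file** (`sumElim_indicator_not_mem_rowSpace_or`, `css_dZ_le_two_pow_of_indicator_zmultiples_mem_ker`):
for every `y ∈ G` of order `2^r` (`r ≥ 0`) with `H = ⟨y⟩`, if `A·1_H = 0` and `B·1_H = 0` (i.e. `1_H ∈ K`; equivalently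
`a, b` lie in the augmentation ideal `I_H = (1 + y)𝔽₂[G]`), then **`(1_H, 0)` or `(0, 1_H)` is a non-trivial `Z`-logical**,
hence **`d_Z(css a b) ≤ 2^r = |1_H|`** (and `d_X` likewise).  So for subgroup indicators in `K` the bound `d ≤ |H|`
HOLDS whenever `H` is a cyclic 2-group — in contrast with `H ≅ ℤ₂ × ℤ₂` (the counterexample), where BOTH one-block words are
stabilizers and `d = 6`.  (With qec-search-8's odd-index quotient lemma `Census/TwoBlockQuotientMaps.lean` the statement
extends to every `H` with CYCLIC Sylow 2-subgroup; that composition is not carried out here.)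

Proof («chain-ring induction», ours).  `S = 𝔽₂[⟨y⟩] = 𝔽₂[η]/(η^q)`, `η = 1 + y`, `q = 2^r`, is a chain ring and `𝔽₂[G]` is
free over it; the only structural input needed is `Ann(η) = (η^{q-1}) = (1_H)` — here: the TRANSVERSAL LEMMA
`exists_conv_indH_eq` of `Census/TwoBlockCyclicKernelTools.lean` (an `H`-periodic function is `1_H ⋆ x₀` for the restriction `x₀` to a transversal of `G/H`, any
subgroup `H`) plus the identity `(1 + Y)^(2^r − 1) = Σ_{l<2^r} Y^l` in characteristic 2 (`one_add_pow_two_pow_sub_one`,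
Frobenius + binary expansion), read in Mathlib's `AddMonoidAlgebra 𝔽₂ G` through the bridge `toAlg` (convolution
`circulant u *ᵥ v` = group-algebra product; after qec-lit-3's private bridge in `AbelianTwoBlockPaddedLogicals.lean`).
The abstract CORE (`pow_eq_zero_of_both_trivial`, any commutative ring): if `Ann(η) ⊆ (η^{q-1})`, `η^q = 0`, `a η^{q-1} =
b η^{q-1} = 0`, and both `η^{q-1} = b s, a s = 0` and `η^{q-1} = a s', b s' = 0` are solvable, then by induction
`a, b ∈ (η^i)` for `i = 1, …, q` (each step: `β s = η^{j}(1 + ηρ)`, `α s = η^{j+1}σ` with `j = q-1-i`, so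
`η^j(α(1+ηρ) − ηβσ) = 0`, so `α ∈ (η)` after inverting the unit `1 + ηρ`), whence `a = 0` and `η^{q-1} = a s' = 0`.
For the code: both one-block words trivial would give exactly such `s, s'` (`sumElim_mem_range_vecMulLinear_HZ_iff`), forcing
`1_H = 0` — absurd.

HONEST FRAMING: a structural theorem of ours about abelian two-block codes; no printed statement is formalized or contradicted.
It explains the cell's data (31 300 structured samples with `H ≅ ℤ₄, ℤ₈`: a one-block coset word is always a logical) and
localises the failure of X-2 at non-cyclic 2-subgroups.  All proved; axioms standard; no `decide` on data; 0 kit.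
-/

namespace Summit.Ventures.QEC.TwoBlockCyclicKernel

open Matrix Literature.InformationTheory.QuantumCodes Literature.InformationTheory.QuantumCodes.AbelianTwoBlock
open Summit.Ventures.QEC.TwoBlockOrderTwo

/-! ## Cyclic subgroups of 2-power order: `1_⟨y⟩` as `(1 + Y)^(2^r - 1)` and the theorem -/

section Cyclic

variable {G : Type*} [AddCommGroup G] [Fintype G] [DecidableEq G]

/-- Coefficients of `Σ_{l < ord y} Y^l` (`Y = single y 1`): the indicator of the cyclic subgroup `⟨y⟩`. -/
theorem coe_coeff_sum_pow_single (y : G) :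
    ⇑(∑ l ∈ Finset.range (addOrderOf y), (AddMonoidAlgebra.single y (1 : ZMod 2)) ^ l).coeff =
      indH (AddSubgroup.zmultiples y) := by
  classical
  funext g
  rw [AddMonoidAlgebra.coeff_sum, Finsupp.coe_finsetSum, Finset.sum_apply]
  simp only [AddMonoidAlgebra.single_pow, one_pow, AddMonoidAlgebra.coeff_single, Finsupp.single_apply]
  rw [Finset.sum_boole, indH]
  by_cases hg : g ∈ AddSubgroup.zmultiples y
  · -- exactly one `l < ord y` with `l • y = g`
    rw [if_pos hg]
    obtain ⟨l, hl, hly⟩ : ∃ l ∈ Finset.range (addOrderOf y), l • y = g := by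
      have := (mem_zmultiples_iff_mem_range_addOrderOf).mp hg
      simpa only [Finset.mem_image] using this
    have hfilter : (Finset.range (addOrderOf y)).filter (fun l' => l' • y = g) = {l} := by
      ext l'
      simp only [Finset.mem_filter, Finset.mem_singleton]
      constructor
      · rintro ⟨hl', hl'y⟩
        exact nsmul_injOn_Iio_addOrderOf (Finset.mem_range.mp hl') (Finset.mem_range.mp hl) (hl'y.trans hly.symm)
      · rintro rfl; exact ⟨hl, hly⟩
    rw [hfilter, Finset.card_singleton, Nat.cast_one]
  · rw [if_neg hg]
    have hfilter : (Finset.range (addOrderOf y)).filter (fun l' => l' • y = g) = ∅ := by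
      ext l'
      simp only [Finset.mem_filter, Finset.notMem_empty, iff_false, not_and]
      intro _ hl'y
      exact hg (hl'y ▸ AddSubgroup.nsmul_mem _ (AddSubgroup.mem_zmultiples y) l')
    rw [hfilter, Finset.card_empty, Nat.cast_zero]

/-- `toAlg 1_⟨y⟩ = Σ_{l < ord y} Y^l`. -/
theorem toAlg_indH_zmultiples (y : G) :
    toAlg (indH (AddSubgroup.zmultiples y)) =
      ∑ l ∈ Finset.range (addOrderOf y), (AddMonoidAlgebra.single y (1 : ZMod 2)) ^ l := by
  rw [← coe_coeff_sum_pow_single, toAlg_coe_coeff]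

/-- `toAlg (δ₀ + δ_y) = 1 + Y`. -/
theorem toAlg_pairInd (y : G) : toAlg (pairInd y) = 1 + AddMonoidAlgebra.single y (1 : ZMod 2) := by
  rw [pairInd, toAlg_add, toAlg_single, toAlg_single, AddMonoidAlgebra.one_def]

omit [Fintype G] [DecidableEq G] in
/-- `Y^(ord y) = 1` for `Y = single y 1`. -/
theorem single_pow_addOrderOf (y : G) : (AddMonoidAlgebra.single y (1 : ZMod 2)) ^ addOrderOf y = 1 := by
  rw [AddMonoidAlgebra.single_pow, one_pow, addOrderOf_nsmul_eq_zero, AddMonoidAlgebra.one_def]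

/-- A `y`-periodic function is periodic along the whole subgroup `⟨y⟩`. -/
theorem periodic_zmultiples_of_periodic {y : G} {x : G → ZMod 2} (hx : ∀ g, x g = x (g - y)) :
    ∀ g h, h ∈ AddSubgroup.zmultiples y → x (g + h) = x g := by
  classical
  have hl : ∀ (g : G) (l : ℕ), x (g + l • y) = x g := by
    intro g l
    induction l with
    | zero => rw [zero_smul, add_zero]
    | succ l ih =>
      rw [succ_nsmul, ← add_assoc, ← ih]
      conv_lhs => rw [hx (g + l • y + y), add_sub_cancel_right]
  intro g h hh
  obtain ⟨l, -, rfl⟩ : ∃ l ∈ Finset.range (addOrderOf y), l • y = h := by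
    have := (mem_zmultiples_iff_mem_range_addOrderOf).mp hh
    simpa only [Finset.mem_image] using this
  exact hl g l

/-- **`(1_H, 0)` or `(0, 1_H)` is a non-trivial `Z`-vector** for `H = ⟨y⟩` cyclic of order `2^r` whenever `1_H ∈ ker A ∩ ker B`:
they cannot both lie in the row space of `H_Z = [Bᵀ|Aᵀ]` (chain-ring induction, see the module docstring). -/
theorem sumElim_indicator_not_mem_rowSpace_or {y : G} {r : ℕ} (hy : addOrderOf y = 2 ^ r) {a b : G → ZMod 2}
    (ha : circulant a *ᵥ indH (AddSubgroup.zmultiples y) = 0) (hb : circulant b *ᵥ indH (AddSubgroup.zmultiples y) = 0) :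
    Sum.elim (indH (AddSubgroup.zmultiples y)) (0 : G → ZMod 2) ∉ LinearMap.range (HZ a b).vecMulLinear ∨
      Sum.elim (0 : G → ZMod 2) (indH (AddSubgroup.zmultiples y)) ∉ LinearMap.range (HZ a b).vecMulLinear := by
  classical
  set N : G → ZMod 2 := indH (AddSubgroup.zmultiples y) with hN
  by_contra hcon
  rw [not_or, not_not, not_not] at hcon
  obtain ⟨h10, h01⟩ := hcon
  obtain ⟨s, hbs, has⟩ := (sumElim_mem_range_vecMulLinear_HZ_iff a b N 0).mp h10
  obtain ⟨s', hbs', has'⟩ := (sumElim_mem_range_vecMulLinear_HZ_iff a b 0 N).mp h01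
  -- move to the group algebra: `η = 1 + Y`, `Y = single y 1`, `N ↦ η^(2^r - 1)`
  have hq1 : 1 ≤ 2 ^ r := Nat.one_le_two_pow
  have hNA : toAlg N = (1 + AddMonoidAlgebra.single y (1 : ZMod 2)) ^ (2 ^ r - 1) := by
    rw [hN, toAlg_indH_zmultiples, hy, one_add_pow_two_pow_sub_one]
  have hηq : (1 + AddMonoidAlgebra.single y (1 : ZMod 2)) ^ (2 ^ r) = 0 := by
    rw [one_add_pow_two_pow, ← hy, single_pow_addOrderOf, alg_add_self]
  have hNη : (1 + AddMonoidAlgebra.single y (1 : ZMod 2)) ^ (2 ^ r - 1) *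
      (1 + AddMonoidAlgebra.single y (1 : ZMod 2)) = 0 := by
    rw [← pow_succ, Nat.sub_add_cancel hq1, hηq]
  -- (P): Ann(η) ⊆ (η^(2^r - 1)), from the transversal lemma
  have hP : ∀ X : AddMonoidAlgebra (ZMod 2) G, X * (1 + AddMonoidAlgebra.single y (1 : ZMod 2)) = 0 →
      ∃ X₀, X = (1 + AddMonoidAlgebra.single y (1 : ZMod 2)) ^ (2 ^ r - 1) * X₀ := by
    intro X hX
    have hper : circulant ⇑X.coeff *ᵥ pairInd y = 0 := by
      have h := congrArg (fun Z : AddMonoidAlgebra (ZMod 2) G => ⇑Z.coeff) hX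
      simp only [coe_coeff_mul] at h
      rw [← coe_coeff_toAlg (pairInd y), toAlg_pairInd, h]
      rfl
    obtain ⟨x₀, hx₀⟩ := exists_conv_indH_eq (AddSubgroup.zmultiples y)
      (periodic_zmultiples_of_periodic ((conv_pairInd_eq_zero_iff _ y).mp hper))
    refine ⟨toAlg x₀, ?_⟩
    rw [← hNA, ← toAlg_conv, hx₀, toAlg_coe_coeff]
  -- transport the four identities and the two kernel conditions
  have t1 : toAlg b * toAlg s = (1 + AddMonoidAlgebra.single y (1 : ZMod 2)) ^ (2 ^ r - 1) := by
    rw [← toAlg_conv, hbs, hNA]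
  have t2 : toAlg a * toAlg s = 0 := by rw [← toAlg_conv, has, toAlg_zero]
  have t3 : toAlg a * toAlg s' = (1 + AddMonoidAlgebra.single y (1 : ZMod 2)) ^ (2 ^ r - 1) := by
    rw [← toAlg_conv, has', hNA]
  have t4 : toAlg b * toAlg s' = 0 := by rw [← toAlg_conv, hbs', toAlg_zero]
  have tA : toAlg a * (1 + AddMonoidAlgebra.single y (1 : ZMod 2)) ^ (2 ^ r - 1) = 0 := by
    rw [← hNA, ← toAlg_conv, ha, toAlg_zero]
  have tB : toAlg b * (1 + AddMonoidAlgebra.single y (1 : ZMod 2)) ^ (2 ^ r - 1) = 0 := by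
    rw [← hNA, ← toAlg_conv, hb, toAlg_zero]
  have hzero : (1 + AddMonoidAlgebra.single y (1 : ZMod 2)) ^ (2 ^ r - 1) = 0 :=
    pow_eq_zero_of_both_trivial _ (2 ^ r) hq1 hP hNη tA tB t1 t2 t3 t4
  -- so 1_H = 0: absurd at g = 0
  have hN0 : N = 0 := toAlg_injective (by rw [hNA, hzero, toAlg_zero])
  have h00 := congr_fun hN0 0
  rw [hN, indH, if_pos (AddSubgroup.zero_mem _)] at h00
  exact one_ne_zero h00

omit [DecidableEq G] in
/-- `|1_⟨y⟩| = ord y`. -/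
theorem hammingNorm_indH_zmultiples (y : G) :
    hammingNorm (indH (AddSubgroup.zmultiples y)) = addOrderOf y := by
  classical
  unfold hammingNorm
  have hset : (Finset.univ.filter fun g : G => indH (AddSubgroup.zmultiples y) g ≠ 0) =
      Finset.univ.filter (fun g : G => g ∈ AddSubgroup.zmultiples y) := by
    ext g
    simp only [Finset.mem_filter, Finset.mem_univ, true_and, indH]
    by_cases hg : g ∈ AddSubgroup.zmultiples y <;> simp [hg]
  rw [hset, ← Fintype.card_subtype]
  convert Fintype.card_zmultiples (x := y)

/-- **Kernel-weight bound for cyclic 2-power cosets.**  For every finite abelian `G`, `a, b ∈ 𝔽₂[G]`, and `y ∈ G` of order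
`2^r`: if the indicator `1_H` of `H = ⟨y⟩` satisfies `A·1_H = 0` and `B·1_H = 0` (`1_H ∈ ker A ∩ ker B`), then
`d_Z(css a b) ≤ 2^r` (`= |1_H|`). -/
theorem css_dZ_le_two_pow_of_indicator_zmultiples_mem_ker {y : G} {r : ℕ} (hy : addOrderOf y = 2 ^ r)
    {a b : G → ZMod 2} (ha : circulant a *ᵥ indH (AddSubgroup.zmultiples y) = 0)
    (hb : circulant b *ᵥ indH (AddSubgroup.zmultiples y) = 0) : (css a b).dZ ≤ 2 ^ r := by
  rw [← hy, ← hammingNorm_indH_zmultiples y]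
  rcases sumElim_indicator_not_mem_rowSpace_or hy ha hb with h | h
  · have hker : (css a b).HX *ᵥ Sum.elim (indH (AddSubgroup.zmultiples y)) (0 : G → ZMod 2) = 0 := by
      rw [css_HX, HX_mulVec_sumElim, Matrix.mulVec_zero, add_zero, ha]
    have hw : hammingNorm (Sum.elim (indH (AddSubgroup.zmultiples y)) (0 : G → ZMod 2)) =
        hammingNorm (indH (AddSubgroup.zmultiples y)) := by
      rw [hammingNorm_sumElim, hammingNorm_zero, add_zero]
    rw [← hw]
    exact (css a b).dZ_le_hammingNorm hker h
  · have hker : (css a b).HX *ᵥ Sum.elim (0 : G → ZMod 2) (indH (AddSubgroup.zmultiples y)) = 0 := by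
      rw [css_HX, HX_mulVec_sumElim, Matrix.mulVec_zero, zero_add, hb]
    have hw : hammingNorm (Sum.elim (0 : G → ZMod 2) (indH (AddSubgroup.zmultiples y))) =
        hammingNorm (indH (AddSubgroup.zmultiples y)) := by
      rw [hammingNorm_sumElim, hammingNorm_zero, zero_add]
    rw [← hw]
    exact (css a b).dZ_le_hammingNorm hker h

/-- Likewise `d_X(css a b) ≤ 2^r` (`d_X = d_Z`). -/
theorem css_dX_le_two_pow_of_indicator_zmultiples_mem_ker {y : G} {r : ℕ} (hy : addOrderOf y = 2 ^ r)
    {a b : G → ZMod 2} (ha : circulant a *ᵥ indH (AddSubgroup.zmultiples y) = 0)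
    (hb : circulant b *ᵥ indH (AddSubgroup.zmultiples y) = 0) : (css a b).dX ≤ 2 ^ r := by
  rw [css_dX_eq_dZ]
  exact css_dZ_le_two_pow_of_indicator_zmultiples_mem_ker hy ha hb

/-- X-2's shape: **`d_Z ≤ |e|` for the kernel element `e = 1_⟨y⟩`**, `y` of order `2^r`. -/
theorem css_dZ_le_hammingNorm_indicator_zmultiples {y : G} {r : ℕ} (hy : addOrderOf y = 2 ^ r)
    {a b : G → ZMod 2} (ha : circulant a *ᵥ indH (AddSubgroup.zmultiples y) = 0)
    (hb : circulant b *ᵥ indH (AddSubgroup.zmultiples y) = 0) :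
    (css a b).dZ ≤ hammingNorm (indH (AddSubgroup.zmultiples y)) := by
  rw [hammingNorm_indH_zmultiples, hy]
  exact css_dZ_le_two_pow_of_indicator_zmultiples_mem_ker hy ha hb

end Cyclic

end Summit.Ventures.QEC.TwoBlockCyclicKernel
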